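import Mathlib
import HarnessLib
import Summits.AtomisticToContinuum.FouriersLaw.Theses.PhononMeanFreePath

/-!
# `PhononMeanFreePath.ChannelsBoundedResponse` — proved (partial assembly, glue)

Item `stmt-AtomisticToContinuum-11816` (support, route `PhononMeanFreePath`, sub-problem `FouriersLaw`):
`NessUnique → BoundaryKubo → CoherentDephasing → IncoherentBounded → BoundedResponse`.

Along a steady-state family `μ` of `pinnedChain ω₂ lam β γ` (all parameters `> 0`) at mean
temperature `T > 0`, let `D N` be the finite-`N` response limits
`lim_{δ → 0, δ ≠ 0} totalCurrent (μ N (T + δ/2) (T - δ/2)) / δ` (assumed to exist, as in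
`BoundedResponse`). `BoundaryKubo` (fed with `NessUnique`) identifies
`D (N+1) = N (γ²/T²) ∫₀^∞ C_N` by uniqueness of limits along the non-trivial filter `𝓝[≠] 0`, and
`D 0 = 0` because the empty chain carries no current (`OscillatorChain.totalCurrent_zero`).
Splitting `∫ C_N = ∫ (C_N - 2 r_N²) + 2 ∫ r_N²` (`integral_sub`), the incoherent part
`N (γ²/T²) ∫ (C_N - 2 r_N²)` is bounded by `IncoherentBounded` and the coherent part `N ∫ r_N²`
converges by `CoherentDephasing`, hence is bounded; so `N ↦ |D N|` is bounded above.
Pure real analysis over the route's hypotheses; no named facts are used.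
-/

namespace Summit.AtomisticToContinuum.FouriersLaw.Theorems

open Filter MeasureTheory Set
open scoped Topology

/-- Real-analysis core of `channelsBoundedResponse_proof`. If the difference quotients `J N` tend,
along the punctured neighbourhood filter of `0`, both to `D N` and (for `N + 1` sites) to
`N · g · ∫₀^∞ Cf N`, with `J 0 → 0`; if the "incoherent" combinations
`N · g · ∫₀^∞ (Cf N - 2 (rf N)²)` are bounded in absolute value by `B`; and if the "coherent"
sequence `N · ∫₀^∞ (rf N)²` converges — then `N ↦ |D N|` is bounded above
(`D 0 = 0`, `D (N+1) = incoherent_N + 2 g · coherent_N`). [folklore] -/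
theorem bddAbove_abs_response_of_channels {Cf rf : ℕ → ℝ → ℝ} {J : ℕ → ℝ → ℝ} {D : ℕ → ℝ}
    {g B c : ℝ}
    (hC : ∀ N, IntegrableOn (Cf N) (Ioi 0))
    (hr : ∀ N, IntegrableOn (fun t => rf N t ^ 2) (Ioi 0))
    (hJ0 : Tendsto (J 0) (𝓝[≠] 0) (𝓝 0))
    (hK : ∀ N : ℕ, Tendsto (J (N + 1)) (𝓝[≠] 0) (𝓝 ((N : ℝ) * g * ∫ t in Ioi (0 : ℝ), Cf N t)))
    (hinc : ∀ N : ℕ, |(N : ℝ) * g * ∫ t in Ioi (0 : ℝ), (Cf N t - 2 * rf N t ^ 2)| ≤ B)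
    (hcoh : Tendsto (fun N : ℕ => (N : ℝ) * ∫ t in Ioi (0 : ℝ), rf N t ^ 2) atTop (𝓝 c))
    (hD : ∀ N, Tendsto (J N) (𝓝[≠] 0) (𝓝 (D N))) :
    BddAbove (Set.range fun N => |D N|) := by
  -- the coherent sequence converges, hence is bounded
  obtain ⟨M, hM⟩ : ∃ M : ℝ, ∀ N : ℕ, |(N : ℝ) * ∫ t in Ioi (0 : ℝ), rf N t ^ 2| ≤ M := by
    obtain ⟨M, hM⟩ := hcoh.abs.bddAbove_range
    exact ⟨M, fun N => hM ⟨N, rfl⟩⟩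
  -- the response coefficients are identified by uniqueness of limits along `𝓝[≠] 0`
  have h0 : D 0 = 0 := tendsto_nhds_unique (hD 0) hJ0
  have hsucc : ∀ N : ℕ, D (N + 1) =
      (N : ℝ) * g * (∫ t in Ioi (0 : ℝ), (Cf N t - 2 * rf N t ^ 2)) +
        2 * g * ((N : ℝ) * ∫ t in Ioi (0 : ℝ), rf N t ^ 2) := by
    intro N
    have h1 : D (N + 1) = (N : ℝ) * g * ∫ t in Ioi (0 : ℝ), Cf N t :=
      tendsto_nhds_unique (hD (N + 1)) (hK N)
    have h2 : IntegrableOn (fun t => 2 * rf N t ^ 2) (Ioi 0) := (hr N).const_mul 2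
    have hsplit : ∫ t in Ioi (0 : ℝ), Cf N t =
        (∫ t in Ioi (0 : ℝ), (Cf N t - 2 * rf N t ^ 2)) + 2 * ∫ t in Ioi (0 : ℝ), rf N t ^ 2 := by
      rw [integral_sub (hC N) h2, integral_const_mul]
      ring
    rw [h1, hsplit]
    ring
  have hB0 : 0 ≤ B := (abs_nonneg _).trans (hinc 0)
  have hM0 : 0 ≤ M := (abs_nonneg _).trans (hM 0)
  refine ⟨B + 2 * |g| * M, ?_⟩
  rintro _ ⟨N, rfl⟩
  cases N with
  | zero =>
    simp only [h0, abs_zero]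
    exact add_nonneg hB0 (mul_nonneg (mul_nonneg zero_le_two (abs_nonneg g)) hM0)
  | succ N =>
    simp only [hsucc N]
    have h3 : |2 * g * ((N : ℝ) * ∫ t in Ioi (0 : ℝ), rf N t ^ 2)| ≤ 2 * |g| * M := by
      rw [abs_mul, abs_mul, abs_two]
      exact mul_le_mul_of_nonneg_left (hM N) (mul_nonneg zero_le_two (abs_nonneg g))
    exact (abs_add_le _ _).trans (add_le_add (hinc N) h3)

/-- **`PhononMeanFreePath.ChannelsBoundedResponse`, PROVED** (item stmt-AtomisticToContinuum-11816,
partial assembly): `NessUnique → BoundaryKubo → CoherentDephasing → IncoherentBounded →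
BoundedResponse`. Given a steady-state family `μ`, `T > 0` and response limits `D N` (existing by
hypothesis), `BoundaryKubo` under `NessUnique` gives `D (N+1) = N (γ²/T²) ∫₀^∞ C_N`
(`tendsto_nhds_unique` on `𝓝[≠] 0`) and `D 0 = 0` (`totalCurrent_zero`); `∫ C_N` splits into the
incoherent part, bounded by `IncoherentBounded`, plus twice the coherent part, convergent by
`CoherentDephasing`; hence `BddAbove (range |D|)`. [folklore] -/
theorem channelsBoundedResponse_proof :
    Summit.AtomisticToContinuum.FouriersLaw.Theses.PhononMeanFreePath.ChannelsBoundedResponse := by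
  unfold Summit.AtomisticToContinuum.FouriersLaw.Theses.PhononMeanFreePath.ChannelsBoundedResponse
  intro hU hK hA hIB ω₂ lam β γ hω hl hβ hγ μ hμ T hT D hD
  have huniq := hU ω₂ lam β γ hω hl hβ hγ
  have hKT := hK ω₂ lam β γ hω hl hβ hγ huniq μ hμ T hT
  have hAT := hA ω₂ lam β γ hω hl hβ hγ T hT
  obtain ⟨B, hB⟩ := hIB ω₂ lam β γ hω hl hβ hγ T hT
  -- C_N (connected power–power correlation) and r_N (momentum pair correlation) of the (N+1)-site chain
  let Cf : ℕ → ℝ → ℝ := fun N t => (∫ z, (z.2 0) ^ 2 * (∫ y, (y.2 (Fin.last N)) ^ 2 ∂((Literature.MathematicalPhysics.KineticTheory.HeatConduction.pinnedChain ω₂ lam β γ).transitionKernel (N + 1) T T t.toNNReal z)) ∂((Literature.MathematicalPhysics.KineticTheory.HeatConduction.pinnedChain ω₂ lam β γ).gibbsMeasure (N + 1) T)) - (∫ z, (z.2 0) ^ 2 ∂((Literature.MathematicalPhysics.KineticTheory.HeatConduction.pinnedChain ω₂ lam β γ).gibbsMeasure (N + 1) T)) * (∫ z, (∫ y, (y.2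 (Fin.last N)) ^ 2 ∂((Literature.MathematicalPhysics.KineticTheory.HeatConduction.pinnedChain ω₂ lam β γ).transitionKernel (N + 1) T T t.toNNReal z)) ∂((Literature.MathematicalPhysics.KineticTheory.HeatConduction.pinnedChain ω₂ lam β γ).gibbsMeasure (N + 1) T))
  let rf : ℕ → ℝ → ℝ := fun N t => ∫ z, z.2 0 * (∫ y, y.2 (Fin.last N) ∂((Literature.MathematicalPhysics.KineticTheory.HeatConduction.pinnedChain ω₂ lam β γ).transitionKernel (N + 1) T T t.toNNReal z)) ∂((Literature.MathematicalPhysics.KineticTheory.HeatConduction.pinnedChain ω₂ lam β γ).gibbsMeasure (N + 1) T)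
  -- the difference quotients of the total current along the family, at mean temperature T
  let J : ℕ → ℝ → ℝ := fun N δ => (Literature.MathematicalPhysics.KineticTheory.HeatConduction.pinnedChain ω₂ lam β γ).totalCurrent (μ N (T + δ / 2) (T - δ / 2)) / δ
  -- the empty chain carries no current
  have hJ0 : Tendsto (J 0) (𝓝[≠] 0) (𝓝 0) := by
    simp only [J, Literature.MathematicalPhysics.KineticTheory.HeatConduction.OscillatorChain.totalCurrent_zero, zero_div]
    exact tendsto_const_nhds
  exact bddAbove_abs_response_of_channels (Cf := Cf) (rf := rf) (J := J) (D := D) (g := γ ^ 2 / T ^ 2)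
    (fun N => (hKT N).1) hAT.1 hJ0 (fun N => (hKT N).2) hB hAT.2 hD

end Summit.AtomisticToContinuum.FouriersLaw.Theorems
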